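import Summits.FinalStateConjecture.FinalStateConjecture.Theorems.EIHFluxBalanceInertialRecessionVirialClassPrep
import Summits.FinalStateConjecture.FinalStateConjecture.Theorems.EIHFluxBalanceInertialRecessionVirialFrozen

/-!
# Route EIHFluxBalance — crux `InertialRecession`, abstract endgame for general `N`:
# LEMMA SPLIT, confined class versus one body — the far-interval analysis

Helper file for the crux `stmt-FinalStateConjecture-10166` (virial route, `work/split/PLAN.md`). Mathlib-only. The analytic core
of `split_of_confined_class_vs_body` (file `…VirialClassVsBody`): given the instances of the window law / identification, the
virial package of the root `𝒦`, the constants and all threshold facts after `T₀`, on every FAR interval `[p, q]`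
(`‖ξ_c − ξ_a‖ ≥ θs`, `q − p ≥ μp`) the relative position `D = ξ_c − ξ_a` has a frozen derivative: `‖Ḋ − W‖ ≤ θ`
(`far_interval_frozen`). Steps: the body `c` is `θ/2`-isolated hence frozen (`velocity_frozen_of_isolated`); the class charges are
frozen (`cluster_charge_frozen`); the virial inequality on the grid of `[p, q]` with `internalEnergy_le'` and `abs_virial_le` makes
`K_𝒦 ≤ kbud` on the whole interval; `mass_mul_norm_sub_coldVelocity_sq_le'` and `norm_coldVelocity_sub_le` freeze `v_a`.
-/

noncomputable section

open Finset Filter Topology MeasureTheory intervalIntegral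

namespace Summit.FinalStateConjecture.FinalStateConjecture.Theorems.SublinearIsFree.Virial

open Literature.Geometry.Lorentzian

variable {N : ℕ}

/-- **Far-interval analysis for a confined class versus one body** (see the module docstring). [folklore] -/
theorem far_interval_frozen (M : Fin N → ℝ) (ξ v : Fin N → ℝ → E3) (κ : ℝ) (P : ℝ → E3 → ℝ → Fin 4 → ℝ)
    (hM : ∀ i, 0 < M i) (hvc : ∀ i, Continuous (v i)) {k : ℝ} (hk0 : 0 ≤ k) (hk1 : k < 1)
    (hvk : ∀ i t, ‖v i t‖ ≤ k) (hv1 : ∀ x t, ‖v x t‖ < 1) (hk2 : 0 < 1 - k ^ 2)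
    (hdiff : ∀ x, Differentiable ℝ (ξ x)) (𝒦 : Finset (Fin N)) {a c : Fin N} (ha : a ∈ 𝒦)
    (hne : 𝒦.Nonempty) (hMK : 0 < ∑ i ∈ 𝒦, M i)
    (ρ : ℝ → ℝ) (C T_W T_I : ℝ) (ζ : ℝ → ℝ)
    (hW : ∀ (t₁ t₂ : ℝ) (c : ℝ → E3) (R : ℝ → ℝ), T_W ≤ t₁ → t₁ ≤ t₂ →
      (∀ s ∈ Set.Icc t₁ t₂, ∀ s' ∈ Set.Icc t₁ t₂, ‖c s - c s'‖ ≤ 2 * |s - s'| ∧ |R s - R s'| ≤ 2 * |s - s'|) →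
      (∀ s ∈ Set.Icc t₁ t₂, ρ s ≤ (1 / 2) * R s ∧ ‖c s‖ + R s ≤ (κ + κ ^ 2) / 2 * s ∧
        ∀ j, ‖ξ j s - c s‖ ≤ (1 - 1 / 2) * R s ∨ (1 + 1 / 2) * R s ≤ ‖ξ j s - c s‖) →
      ∀ μ : Fin 4, |P t₂ (c t₂) (R t₂) μ - P t₁ (c t₁) (R t₁) μ| ≤ C * ∫ s in t₁..t₂, (R s ^ (3 / 2 : ℝ))⁻¹)
    (hI : ∀ (t : ℝ) (c : E3) (R : ℝ) (A : Finset (Fin N)), T_I ≤ t → ρ t ≤ (1 / 2) * R →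
      ‖c‖ + R ≤ (κ + κ ^ 2) / 2 * t →
      (∀ j, ‖ξ j t - c‖ ≤ (1 - 1 / 2) * R ∨ (1 + 1 / 2) * R ≤ ‖ξ j t - c‖) →
      (∀ j, j ∈ A ↔ ‖ξ j t - c‖ ≤ (1 - 1 / 2) * R) →
      |P t c R 0 - ∑ j ∈ A, M j * (√(1 - ‖v j t‖ ^ 2))⁻¹| ≤ ζ t ∧
      ∀ k : Fin 3, |P t c R k.succ - ∑ j ∈ A, M j * (√(1 - ‖v j t‖ ^ 2))⁻¹ * v j t k| ≤ ζ t)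
    {h CJ T₂ : ℝ} {ε : ℝ → ℝ} (hh : 0 < h) (hCJ : 0 ≤ CJ) (hεa : Antitone ε)
    (hvir : ∀ T : ℝ, T₂ ≤ T → ∀ n : ℕ,
      (∀ m : ℕ, m ≤ n → ∃ D G : ℝ, (∀ x ∈ 𝒦, ∀ y ∈ 𝒦, ‖ξ x (T + m * h) - ξ y (T + m * h)‖ ≤ D) ∧
        (∀ x ∈ 𝒦, ∀ z ∈ univ \ 𝒦, G ≤ ‖ξ x (T + m * h) - ξ z (T + m * h)‖) ∧ 1 * D < G) →
      ∀ Dn : ℝ, 0 ≤ Dn → (∀ x ∈ 𝒦, ∀ y ∈ 𝒦, ‖ξ x (T + n * h) - ξ y (T + n * h)‖ ≤ Dn) →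
      (2 * ∑ i ∈ 𝒦, M i)⁻¹ * (∫ s in T..(T + n * h), ∑ j ∈ 𝒦, ∑ l ∈ 𝒦, M j * M l * ‖v j s - v l s‖ ^ 2) -
          (∫ t in T..(T + n * h), ε t) - CJ * Dn ≤
        (∑ j ∈ 𝒦, inner ℝ ((M j * (√(1 - ‖v j (T + n * h)‖ ^ 2))⁻¹) • v j (T + n * h))
            (ξ j (T + n * h) - (∑ l ∈ 𝒦, M l)⁻¹ • ∑ l ∈ 𝒦, M l • ξ l (T + n * h))) -
        (∑ j ∈ 𝒦, inner ℝ ((M j * (√(1 - ‖v j T‖ ^ 2))⁻¹) • v j T)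
            (ξ j T - (∑ l ∈ 𝒦, M l)⁻¹ • ∑ l ∈ 𝒦, M l • ξ l T)))
    {σ θ s₀ B K μ η' kbud κ₁ κ₂ C' A' T₀ : ℝ} (hσ : 0 < σ) (hθ0 : 0 < θ) (hθ1 : θ ≤ 1) (hθσ : θ ≤ σ / 2)
    (hμdef : μ = (s₀ / 2 - (θ + B / K)) / 2) (hμ0 : 0 < μ) (hη'0 : 0 < η') (hη'θ : η' ≤ θ / 16)
    (hkbdef : kbud = θ ^ 2 * M a / (32 * ((√(1 - k ^ 2))⁻¹) ^ 3))
    (hC'def : C' = 2 * ((√(1 - k ^ 2))⁻¹) ^ 8 / ∑ i ∈ 𝒦, M i) (hC'0 : 0 < C')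
    (hA'def : A' = (∑ i ∈ 𝒦, M i) * (√(1 - k ^ 2))⁻¹) (hA'0 : 0 ≤ A')
    (hκ₂def : κ₂ = C' * (2 * ∑ i ∈ 𝒦, M i)) (hκ₂0 : 0 < κ₂)
    (hκ₁def : κ₁ = κ₂ * (2 * A' + CJ) * (1 + 2 / μ)) (hη'k : κ₁ * η' ≤ kbud / 3)
    (hT₀pos : 0 < T₀) (h0W : T_W ≤ T₀) (h0I : T_I ≤ T₀) (h02 : T₂ ≤ T₀) (h0h : 4 * h / μ ≤ T₀)
    (hslave1 : ∀ x s, T₀ ≤ s → ‖deriv (ξ x) s - v x s‖ ≤ min (1 - k) (θ / 8))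
    (hspeed2 : ∀ x s, T₀ ≤ s → ‖deriv (ξ x) s‖ ≤ 2)
    (hconfT : ∀ s, T₀ ≤ s → ∀ x ∈ 𝒦, ∀ y ∈ 𝒦, ‖ξ x s - ξ y s‖ ≤ η' * s)
    (hrestT : ∀ s, T₀ ≤ s → ∀ x ∈ insert c 𝒦, ∀ z ∉ insert c 𝒦, σ * s ≤ ‖ξ z s - ξ x s‖)
    (hsqrt : ∀ s, T₀ ≤ s → ρ s ≤ θ / 2 * s / 8)
    (hcapT : ∀ x s, T₀ ≤ s → ‖ξ x s‖ + θ / 2 / 4 * s ≤ (κ + κ ^ 2) / 2 * s)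
    (hBdle : ∀ p s, T₀ ≤ p → p ≤ s →
      |C| * (2 * ((θ / 2 / 4) ^ (3 / 2 : ℝ))⁻¹ * (p ^ (1 / 2 : ℝ))⁻¹) + ζ p + ζ s ≤
        min (θ * min (M c) (∑ i ∈ 𝒦, M i) / 72) (kbud / 24))
    (hεT : ∀ p, T₀ ≤ p → ε p ≤ kbud / (3 * κ₂))
    {D : ℝ → E3} (hDap : ∀ t, D t = ξ c t - ξ a t) (hDder : ∀ t, deriv D t = deriv (ξ c) t - deriv (ξ a) t) :
    ∀ p q : ℝ, T₀ ≤ p → p ≤ q → (s₀ / 2 - (θ + B / K)) / 2 * p ≤ q - p →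
      (∀ s ∈ Set.Icc p q, θ * s ≤ ‖D s‖) → ∃ W : E3, ∀ s ∈ Set.Icc p q, ‖deriv D s - W‖ ≤ θ := by
    classical
    intro p q hp hpq hlen hfar
    rw [← hμdef] at hlen
    have hp0 : 0 < p := hT₀pos.trans_le hp
    -- (F1) the body `c` is `θ/2`-isolated, its velocity is frozen
    have hisoc : ∀ s ∈ Set.Icc p q, ∀ y, y ≠ c → θ / 2 * s ≤ ‖ξ y s - ξ c s‖ := by
      intro s hs y hy
      have hs' : T₀ ≤ s := hp.trans hs.1
      by_cases hyK : y ∈ 𝒦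
      · have h1 := hfar s hs
        rw [hDap] at h1
        have h2 := hconfT s hs' y hyK a ha
        have h3 : ‖ξ c s - ξ a s‖ ≤ ‖ξ y s - ξ c s‖ + ‖ξ y s - ξ a s‖ := by
          calc ‖ξ c s - ξ a s‖ = ‖(ξ y s - ξ a s) - (ξ y s - ξ c s)‖ := by congr 1; abel
            _ ≤ ‖ξ y s - ξ a s‖ + ‖ξ y s - ξ c s‖ := norm_sub_le _ _
            _ = ‖ξ y s - ξ c s‖ + ‖ξ y s - ξ a s‖ := add_comm _ _
        have hs0 : 0 ≤ s := by linarith only [hs', hT₀pos]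
        have h4 : η' * s ≤ θ / 16 * s := mul_le_mul_of_nonneg_right hη'θ hs0
        have h5 : 0 ≤ θ * s := mul_nonneg hθ0.le hs0
        linarith only [h1, h2, h3, h4, h5]
      · have hy' : y ∉ insert c 𝒦 := by simp [hy, hyK]
        have h1 := hrestT s hs' c (Finset.mem_insert_self _ _) y hy'
        have hs0 : 0 ≤ s := by linarith only [hs', hT₀pos]
        have h4 : θ / 2 * s ≤ σ * s := mul_le_mul_of_nonneg_right (by linarith only [hθσ, hσ]) hs0
        linarith only [h1, h4]
    have hvcf : ∀ s ∈ Set.Icc p q, ‖v c s - v c p‖ ≤ θ / 12 := by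
      intro s hs
      have h := velocity_frozen_of_isolated M ξ v κ P ρ C T_W T_I T₀ ζ hW hI hdiff hspeed2 (hM c) (hv1 c)
        (half_pos hθ0) (by linarith only [hθ1]) (h0W.trans hp) (h0I.trans hp) hp hp0 hs.1
        (fun s' hs' ↦ hsqrt s' (hp.trans hs'.1)) (fun s' hs' ↦ hcapT c s' (hp.trans hs'.1))
        (fun s' hs' y hy ↦ hisoc s' ⟨hs'.1, hs'.2.trans hs.2⟩ y hy)
      have hb := (hBdle p s hp hs.1).trans (min_le_left _ _)
      have hm : min (M c) (∑ i ∈ 𝒦, M i) ≤ M c := min_le_left _ _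
      refine h.trans ?_
      rw [div_le_iff₀ (hM c)]
      have hq' : θ * min (M c) (∑ i ∈ 𝒦, M i) ≤ θ * M c := mul_le_mul_of_nonneg_left hm hθ0.le
      linarith only [hb, hq']
    -- (F2) the class charges are frozen
    have hclu : ∀ s ∈ Set.Icc p q,
        |∑ j ∈ 𝒦, M j * (√(1 - ‖v j s‖ ^ 2))⁻¹ - ∑ j ∈ 𝒦, M j * (√(1 - ‖v j p‖ ^ 2))⁻¹| ≤ kbud / 24 ∧
        ‖∑ j ∈ 𝒦, (M j * (√(1 - ‖v j s‖ ^ 2))⁻¹) • v j s - ∑ j ∈ 𝒦, (M j * (√(1 - ‖v j p‖ ^ 2))⁻¹) • v j p‖ ≤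
          3 * (θ * min (M c) (∑ i ∈ 𝒦, M i) / 72) ∧
        |(∑ j ∈ 𝒦, M j * (√(1 - ‖v j s‖ ^ 2))⁻¹ -
            √((∑ i ∈ 𝒦, M i) ^ 2 + ‖∑ j ∈ 𝒦, (M j * (√(1 - ‖v j s‖ ^ 2))⁻¹) • v j s‖ ^ 2)) -
          (∑ j ∈ 𝒦, M j * (√(1 - ‖v j p‖ ^ 2))⁻¹ -
            √((∑ i ∈ 𝒦, M i) ^ 2 + ‖∑ j ∈ 𝒦, (M j * (√(1 - ‖v j p‖ ^ 2))⁻¹) • v j p‖ ^ 2))| ≤ 4 * (kbud / 24) := by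
      intro s hs
      have h := cluster_charge_frozen M ξ v κ P ρ C T_W T_I T₀ ζ hW hI hdiff hspeed2 (A := 𝒦) (a := a)
        (half_pos hθ0) (by linarith only [hθ1]) (h0W.trans hp) (h0I.trans hp) hp hp0 hs.1
        (fun s' hs' ↦ hsqrt s' (hp.trans hs'.1)) (fun s' hs' ↦ hcapT a s' (hp.trans hs'.1))
        (fun s' hs' i hi ↦ by
          have h1 := hconfT s' (hp.trans hs'.1) i hi a ha
          have hs0 : 0 ≤ s' := by linarith only [hs'.1, hp, hT₀pos]
          have h4 : η' * s' ≤ θ / 16 * s' := mul_le_mul_of_nonneg_right hη'θ hs0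
          linarith only [h1, h4])
        (fun s' hs' j hj ↦ by
          have hs'' : s' ∈ Set.Icc p q := ⟨hs'.1, hs'.2.trans hs.2⟩
          by_cases hjc : j = c
          · rw [hjc]
            have h1 := hfar s' hs''
            rw [hDap] at h1
            have hs0 : 0 ≤ s' := by linarith only [hs'.1, hp, hT₀pos]
            have h5 : θ / 2 * s' ≤ θ * s' := by nlinarith only [hθ0, hs0]
            exact h5.trans h1
          · have hj' : j ∉ insert c 𝒦 := by simp [hjc, hj]
            have h1 := hrestT s' (hp.trans hs'.1) a (Finset.mem_insert_of_mem ha) j hj'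
            have hs0 : 0 ≤ s' := by linarith only [hs'.1, hp, hT₀pos]
            have h4 : θ / 2 * s' ≤ σ * s' := mul_le_mul_of_nonneg_right (by linarith only [hθσ, hσ]) hs0
            linarith only [h1, h4])
      have hb := hBdle p s hp hs.1
      have hb1 := hb.trans (min_le_left _ _)
      have hb2 := hb.trans (min_le_right _ _)
      exact ⟨h.1.trans hb2, h.2.1.trans (by linarith only [hb1]), h.2.2.trans (by linarith only [hb2])⟩
    -- (F3) the virial inequality on the grid of `[p, q]`: `min K ≤ κ₁ η' + κ₂ ε(p)`
    obtain ⟨n, hndef⟩ : ∃ n : ℕ, n = ⌊(q - p) / h⌋₊ := ⟨_, rfl⟩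
    have hnle : (n : ℝ) * h ≤ q - p := by
      have h1 : (n : ℝ) ≤ (q - p) / h := by rw [hndef]; exact Nat.floor_le (by positivity)
      rwa [le_div_iff₀ hh] at h1
    have hnge : μ * p / 2 ≤ (n : ℝ) * h := by
      have h1 : (q - p) / h < n + 1 := by rw [hndef]; exact Nat.lt_floor_add_one _
      rw [div_lt_iff₀ hh] at h1
      have h2 : h ≤ μ * p / 4 := by
        have := (div_le_iff₀ hμ0).mp (h0h.trans hp)
        linarith only [this]
      nlinarith only [h1, h2, hlen, hh]
    have hnh0 : 0 < (n : ℝ) * h := lt_of_lt_of_le (by positivity) hnge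
    have hgridK : ∀ m : ℕ, m ≤ n → p + m * h ∈ Set.Icc p q := fun m hm ↦ by
      have h1 : (m : ℝ) * h ≤ n * h := mul_le_mul_of_nonneg_right (by exact_mod_cast hm) hh.le
      exact ⟨le_add_of_nonneg_right (by positivity), by linarith only [h1, hnle]⟩
    have hv := hvir p (h02.trans hp) n (fun m hm ↦ by
      have hm' := hgridK m hm
      have ht' : T₀ ≤ p + m * h := hp.trans hm'.1
      have ht0 : 0 < p + m * h := hT₀pos.trans_le ht'
      refine ⟨η' * (p + m * h), θ / 2 * (p + m * h), hconfT _ ht', fun x hx z hz ↦ ?_, by nlinarith only [hη'θ, ht0, hθ0]⟩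
      have hzK : z ∉ 𝒦 := (Finset.mem_sdiff.mp hz).2
      by_cases hzc : z = c
      · subst hzc
        have h1 := hfar _ hm'
        rw [hDap] at h1
        have h2 := hconfT _ ht' x hx a ha
        have h3 : ‖ξ z (p + m * h) - ξ a (p + m * h)‖ ≤
            ‖ξ x (p + m * h) - ξ z (p + m * h)‖ + ‖ξ x (p + m * h) - ξ a (p + m * h)‖ := by
          calc ‖ξ z (p + m * h) - ξ a (p + m * h)‖
              = ‖(ξ x (p + m * h) - ξ a (p + m * h)) - (ξ x (p + m * h) - ξ z (p + m * h))‖ := by congr 1; abel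
            _ ≤ ‖ξ x (p + m * h) - ξ a (p + m * h)‖ + ‖ξ x (p + m * h) - ξ z (p + m * h)‖ := norm_sub_le _ _
            _ = _ := add_comm _ _
        have h4 : η' * (p + m * h) ≤ θ / 16 * (p + m * h) := mul_le_mul_of_nonneg_right hη'θ ht0.le
        have h5 : 0 ≤ θ * (p + m * h) := mul_nonneg hθ0.le ht0.le
        linarith only [h1, h2, h3, h4, h5]
      · have hz' : z ∉ insert c 𝒦 := by simp [hzc, hzK]
        have h1 := hrestT _ ht' x (Finset.mem_insert_of_mem hx) z hz'
        rw [norm_sub_rev] at h1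
        have h4 : θ / 2 * (p + m * h) ≤ σ * (p + m * h) := mul_le_mul_of_nonneg_right (by linarith only [hθσ, hσ]) ht0.le
        linarith only [h1, h4])
      (η' * (p + n * h)) (by have := (hgridK n le_rfl).1; nlinarith only [hη'0, hp0, this]) (hconfT _ (hp.trans (hgridK n le_rfl).1))
    -- bound the pieces of the virial inequality
    have hGb : ∀ t, T₀ ≤ t → |∑ j ∈ 𝒦, inner ℝ ((M j * (√(1 - ‖v j t‖ ^ 2))⁻¹) • v j t)
        (ξ j t - (∑ l ∈ 𝒦, M l)⁻¹ • ∑ l ∈ 𝒦, M l • ξ l t)| ≤ A' * (η' * t) := fun t ht ↦ by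
      rw [hA'def]
      exact abs_virial_le 𝒦 M hM hne hk2 (fun i ↦ ξ i t) (fun i ↦ v i t) (fun i ↦ hvk i t) (hconfT t ht)
    have hG1 := hGb (p + n * h) (hp.trans (hgridK n le_rfl).1)
    have hG0 := hGb p hp
    have hεi : ∫ t in p..(p + n * h), ε t ≤ ε p * (n * h) := by
      have hle : p ≤ p + n * h := le_add_of_nonneg_right hnh0.le
      calc ∫ t in p..(p + n * h), ε t ≤ ∫ _ in p..(p + n * h), ε p :=
            intervalIntegral.integral_mono_on hle hεa.intervalIntegrable intervalIntegrable_const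
              fun t ht ↦ hεa ht.1
        _ = ε p * (n * h) := by rw [intervalIntegral.integral_const, smul_eq_mul]; ring
    have hεp : ε p ≤ kbud / (3 * κ₂) := hεT p hp
    -- `K ≥ K_min := K(p) - 4 kbud/24` on `[p, q]` and `σ₂ ≥ K / C'`
    obtain ⟨Kp, hKpdef⟩ : ∃ Kp : ℝ, Kp = ∑ j ∈ 𝒦, M j * (√(1 - ‖v j p‖ ^ 2))⁻¹ -
        √((∑ i ∈ 𝒦, M i) ^ 2 + ‖∑ j ∈ 𝒦, (M j * (√(1 - ‖v j p‖ ^ 2))⁻¹) • v j p‖ ^ 2) := ⟨_, rfl⟩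
    have hKlow : ∀ s ∈ Set.Icc p q, Kp - 4 * (kbud / 24) ≤ ∑ j ∈ 𝒦, M j * (√(1 - ‖v j s‖ ^ 2))⁻¹ -
        √((∑ i ∈ 𝒦, M i) ^ 2 + ‖∑ j ∈ 𝒦, (M j * (√(1 - ‖v j s‖ ^ 2))⁻¹) • v j s‖ ^ 2) := fun s hs ↦ by
      have h := (hclu s hs).2.2
      rw [← hKpdef, abs_le] at h
      linarith only [h.1]
    have hKup : ∀ s ∈ Set.Icc p q, ∑ j ∈ 𝒦, M j * (√(1 - ‖v j s‖ ^ 2))⁻¹ -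
        √((∑ i ∈ 𝒦, M i) ^ 2 + ‖∑ j ∈ 𝒦, (M j * (√(1 - ‖v j s‖ ^ 2))⁻¹) • v j s‖ ^ 2) ≤ Kp + 4 * (kbud / 24) :=
      fun s hs ↦ by
      have h := (hclu s hs).2.2
      rw [← hKpdef, abs_le] at h
      linarith only [h.2]
    have hσlow : ∀ s ∈ Set.Icc p (p + n * h),
        (Kp - 4 * (kbud / 24)) / C' ≤ ∑ j ∈ 𝒦, ∑ l ∈ 𝒦, M j * M l * ‖v j s - v l s‖ ^ 2 := fun s hs ↦ by
      have hs' : s ∈ Set.Icc p q := ⟨hs.1, hs.2.trans (hgridK n le_rfl).2⟩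
      have h1 := hKlow s hs'
      have h2 := internalEnergy_le' 𝒦 M (fun j ↦ v j s) (fun i _ ↦ hM i) hk1 (fun i _ ↦ hvk i s) hne
      rw [← hC'def] at h2
      rw [div_le_iff₀ hC'0]
      nlinarith only [h1, h2, hC'0]
    have hσc : Continuous fun t ↦ ∑ j ∈ 𝒦, ∑ l ∈ 𝒦, M j * M l * ‖v j t - v l t‖ ^ 2 :=
      continuous_finsetSum _ fun j _ ↦ continuous_finsetSum _ fun l _ ↦
        continuous_const.mul (((hvc j).sub (hvc l)).norm.pow 2)
    have hσi : (Kp - 4 * (kbud / 24)) / C' * (n * h) ≤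
        ∫ s in p..(p + n * h), ∑ j ∈ 𝒦, ∑ l ∈ 𝒦, M j * M l * ‖v j s - v l s‖ ^ 2 := by
      have hle : p ≤ p + n * h := le_add_of_nonneg_right hnh0.le
      calc (Kp - 4 * (kbud / 24)) / C' * (n * h) = ∫ _ in p..(p + n * h), (Kp - 4 * (kbud / 24)) / C' := by
            rw [intervalIntegral.integral_const, smul_eq_mul]; ring
        _ ≤ _ := intervalIntegral.integral_mono_on hle intervalIntegrable_const (hσc.intervalIntegrable _ _) hσlow
    -- combine: `Kp ≤ κ₁ η' + κ₂ ε p + 4 kbud / 24`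
    have hKp : Kp ≤ κ₁ * η' + κ₂ * ε p + 4 * (kbud / 24) := by
      have hG1' := (abs_le.mp hG1).2
      have hG0' := (abs_le.mp hG0).1
      -- from `hv`: c₁ ∫σ₂ - ∫ε - CJ Dn ≤ G₁ - G₀
      have hc1 : 0 < (2 * ∑ i ∈ 𝒦, M i)⁻¹ := by positivity
      have hmain : (2 * ∑ i ∈ 𝒦, M i)⁻¹ * ((Kp - 4 * (kbud / 24)) / C' * (n * h)) ≤
          2 * (A' * (η' * (p + n * h))) + ε p * (n * h) + CJ * (η' * (p + n * h)) := by
        have e1 := mul_le_mul_of_nonneg_left hσi hc1.le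
        have hpn : η' * p ≤ η' * (p + n * h) := mul_le_mul_of_nonneg_left (le_add_of_nonneg_right hnh0.le) hη'0.le
        nlinarith only [hv, e1, hεi, hG1', hG0', hpn, hA'0]
      -- divide by `c₁ (n h) / C'` and use `(p + n h)/(n h) ≤ 1 + 2/μ`
      have hratio : p + n * h ≤ (1 + 2 / μ) * (n * h) := by
        have h1 : p ≤ 2 / μ * (n * h) := by
          rw [div_mul_eq_mul_div, le_div_iff₀ hμ0]
          linarith only [hnge]
        linarith only [h1]
      have hK2' : (Kp - 4 * (kbud / 24)) * (n * h) ≤ κ₂ * ((2 * A' + CJ) * (η' * (p + n * h)) + ε p * (n * h)) := by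
        rw [hκ₂def]
        have e2 := mul_le_mul_of_nonneg_left hmain (by positivity : (0 : ℝ) ≤ C' * (2 * ∑ i ∈ 𝒦, M i))
        have e3 : C' * (2 * ∑ i ∈ 𝒦, M i) * ((2 * ∑ i ∈ 𝒦, M i)⁻¹ * ((Kp - 4 * (kbud / 24)) / C' * (n * h))) =
            (Kp - 4 * (kbud / 24)) * (n * h) := by field_simp
        nlinarith only [e2, e3]
      have hK3 : (Kp - 4 * (kbud / 24)) * (n * h) ≤ (κ₁ * η' + κ₂ * ε p) * (n * h) := by
        rw [hκ₁def]
        have e4 : η' * (p + n * h) ≤ η' * ((1 + 2 / μ) * (n * h)) := mul_le_mul_of_nonneg_left hratio hη'0.le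
        have e5 : 0 ≤ κ₂ * (2 * A' + CJ) := by positivity
        nlinarith only [hK2', e4, e5]
      have := le_of_mul_le_mul_right hK3 hnh0
      linarith only [this]
    -- (F4) coldness on `[p, q]` and the member velocity
    have hKs : ∀ s ∈ Set.Icc p q, ∑ j ∈ 𝒦, M j * (√(1 - ‖v j s‖ ^ 2))⁻¹ -
        √((∑ i ∈ 𝒦, M i) ^ 2 + ‖∑ j ∈ 𝒦, (M j * (√(1 - ‖v j s‖ ^ 2))⁻¹) • v j s‖ ^ 2) ≤ kbud := fun s hs ↦ by
      have h1 := hKup s hs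
      have h2 : κ₂ * ε p ≤ kbud / 3 := by
        have := mul_le_mul_of_nonneg_left hεp hκ₂0.le
        have e : κ₂ * (kbud / (3 * κ₂)) = kbud / 3 := by field_simp
        linarith only [this, e]
      linarith only [h1, hKp, hη'k, h2]
    have hva : ∀ s ∈ Set.Icc p q, ‖v a s - (√((∑ i ∈ 𝒦, M i) ^ 2 +
        ‖∑ j ∈ 𝒦, (M j * (√(1 - ‖v j s‖ ^ 2))⁻¹) • v j s‖ ^ 2))⁻¹ •
          ∑ j ∈ 𝒦, (M j * (√(1 - ‖v j s‖ ^ 2))⁻¹) • v j s‖ ≤ θ / 4 := fun s hs ↦ by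
      have h := mass_mul_norm_sub_coldVelocity_sq_le' 𝒦 M (fun j ↦ v j s) (fun i _ ↦ hM i) hk0 hk1
        (fun i _ ↦ hvk i s) ha
      have hK := hKs s hs
      have hMa := hM a
      have hsq : ‖v a s - (√((∑ i ∈ 𝒦, M i) ^ 2 +
          ‖∑ j ∈ 𝒦, (M j * (√(1 - ‖v j s‖ ^ 2))⁻¹) • v j s‖ ^ 2))⁻¹ •
            ∑ j ∈ 𝒦, (M j * (√(1 - ‖v j s‖ ^ 2))⁻¹) • v j s‖ ^ 2 ≤ (θ / 4) ^ 2 := by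
        have e1 : 2 * ((√(1 - k ^ 2))⁻¹) ^ 3 * kbud = θ ^ 2 * M a / 16 := by
          rw [hkbdef]; field_simp; ring
        have e2 := mul_le_mul_of_nonneg_left hK (by positivity : (0 : ℝ) ≤ 2 * ((√(1 - k ^ 2))⁻¹) ^ 3)
        have e3 := h.trans e2
        rw [e1] at e3
        have e4 : M a * (θ / 4) ^ 2 = θ ^ 2 * M a / 16 := by ring
        rw [← e4] at e3
        exact le_of_mul_le_mul_left e3 hMa
      exact (sq_le_sq₀ (norm_nonneg _) (by positivity)).mp hsq
    have hVf : ∀ s ∈ Set.Icc p q, ‖(√((∑ i ∈ 𝒦, M i) ^ 2 +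
        ‖∑ j ∈ 𝒦, (M j * (√(1 - ‖v j s‖ ^ 2))⁻¹) • v j s‖ ^ 2))⁻¹ • ∑ j ∈ 𝒦, (M j * (√(1 - ‖v j s‖ ^ 2))⁻¹) • v j s -
        (√((∑ i ∈ 𝒦, M i) ^ 2 + ‖∑ j ∈ 𝒦, (M j * (√(1 - ‖v j p‖ ^ 2))⁻¹) • v j p‖ ^ 2))⁻¹ •
          ∑ j ∈ 𝒦, (M j * (√(1 - ‖v j p‖ ^ 2))⁻¹) • v j p‖ ≤ θ / 4 := fun s hs ↦ by
      have h := norm_coldVelocity_sub_le hMK (∑ j ∈ 𝒦, (M j * (√(1 - ‖v j s‖ ^ 2))⁻¹) • v j s)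
        (∑ j ∈ 𝒦, (M j * (√(1 - ‖v j p‖ ^ 2))⁻¹) • v j p)
      have hP := (hclu s hs).2.1
      refine h.trans ?_
      rw [div_le_iff₀ hMK]
      have hm : min (M c) (∑ i ∈ 𝒦, M i) ≤ ∑ i ∈ 𝒦, M i := min_le_right _ _
      have hq' : θ * min (M c) (∑ i ∈ 𝒦, M i) ≤ θ * ∑ i ∈ 𝒦, M i := mul_le_mul_of_nonneg_left hm hθ0.le
      linarith only [hP, hq']
    -- (F5) assemble the frozen derivative
    obtain ⟨Vp, hVp⟩ : ∃ V : E3, V = (√((∑ i ∈ 𝒦, M i) ^ 2 +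
        ‖∑ j ∈ 𝒦, (M j * (√(1 - ‖v j p‖ ^ 2))⁻¹) • v j p‖ ^ 2))⁻¹ • ∑ j ∈ 𝒦, (M j * (√(1 - ‖v j p‖ ^ 2))⁻¹) • v j p :=
      ⟨_, rfl⟩
    refine ⟨v c p - Vp, fun s hs ↦ ?_⟩
    obtain ⟨Vs, hVs⟩ : ∃ V : E3, V = (√((∑ i ∈ 𝒦, M i) ^ 2 +
        ‖∑ j ∈ 𝒦, (M j * (√(1 - ‖v j s‖ ^ 2))⁻¹) • v j s‖ ^ 2))⁻¹ • ∑ j ∈ 𝒦, (M j * (√(1 - ‖v j s‖ ^ 2))⁻¹) • v j s :=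
      ⟨_, rfl⟩
    have hs' : T₀ ≤ s := hp.trans hs.1
    have e1 := hslave1 c s hs'
    have e2 := hslave1 a s hs'
    have e3 := hvcf s hs
    have e4 := hva s hs
    rw [← hVs] at e4
    have e5 := hVf s hs
    rw [← hVs, ← hVp] at e5
    have hm := min_le_right (1 - k) (θ / 8)
    calc ‖deriv D s - (v c p - Vp)‖
        = ‖(deriv (ξ c) s - v c s) - (deriv (ξ a) s - v a s) + (v c s - v c p) - (v a s - Vs) - (Vs - Vp)‖ := by
          rw [hDder]; congr 1; abel
      _ ≤ ‖deriv (ξ c) s - v c s‖ + ‖deriv (ξ a) s - v a s‖ + ‖v c s - v c p‖ + ‖v a s - Vs‖ + ‖Vs - Vp‖ := by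
          refine (norm_sub_le _ _).trans (add_le_add ?_ le_rfl)
          refine (norm_sub_le _ _).trans (add_le_add ?_ le_rfl)
          exact (norm_add_le _ _).trans (add_le_add (norm_sub_le _ _) le_rfl)
      _ ≤ θ := by linarith only [e1, e2, e3, e4, e5, hm, hθ0]

/-- Registered one-line helper of this file: the grid of step `h` laid in `[p, q]` covers all but one step. [folklore] -/
theorem floor_mul_le_and_lt' : ∀ {x h : ℝ}, 0 < h → 0 ≤ x → (⌊x / h⌋₊ : ℝ) * h ≤ x ∧ x - h < (⌊x / h⌋₊ : ℝ) * h := by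
  intro x h hh hx
  constructor
  · have h1 : (⌊x / h⌋₊ : ℝ) ≤ x / h := Nat.floor_le (by positivity)
    rwa [le_div_iff₀ hh] at h1
  · have h1 : x / h < ⌊x / h⌋₊ + 1 := Nat.lt_floor_add_one _
    rw [div_lt_iff₀ hh] at h1
    linarith

end Summit.FinalStateConjecture.FinalStateConjecture.Theorems.SublinearIsFree.Virial

end
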